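import Summits.BirchSwinnertonDyer.Rank1Residual.Additive.QuadraticBranchBSDpOfReadings
import Summits.BirchSwinnertonDyer.Rank1Residual.Additive.QuadraticBranchPAdicGrossZagierValuation
import Summits.BirchSwinnertonDyer.Rank1Residual.Additive.QuadraticBranchConsumersNoTorsionHyp
import Summits.BirchSwinnertonDyer.Rank1Residual.Additive.QuadraticBranchMinusLFunctionExistence
import Literature.NumberTheory.EllipticCurves.StrictSelmerRankOne
import Literature.NumberTheory.DiophantineGeometry.Conductor
import HarnessLib

/-!
# (C2_η) `QuadraticBranchRankOneLinkAt W p` — the branch rank-one link "(C1_η) ⟹ `PPart W p`" — is a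
# THEOREM modulo C-cc-1 = (C2_η-GZ), the named facts and the two print-shaped readings of x1b GEN 44's
# file 124, for `p ≥ 5` (cell `b2b-bsdres`, lane CLASS-CLOSURE §3.14, seat x1b GEN 45, file 128;
# bookkeeping over the tree's theorems; nothing asserted, nothing booked)

HONEST FRAMING (cell `b2b-bsdres`, run/shared/lean/b2b/bsd-rank1-residual/, verbatim in every
file): the goal of the cell is to DELETE the COMBINATION-SHAPED residual classes of the
Birch–Swinnerton-Dyer formula for ALL analytic-rank `≤ 1` elliptic curves over `ℚ` — "full BSD
formula for every rank `≤ 1` curve in class `C`" assembled STRICTLY from published theorems — so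
that the rank-`≤ 1` remainder becomes exactly the CONSTRUCTION-SHAPED classes, which are TYPED
(missing-input `Prop`s), NOT attempted. This is not "finishing BSD". Research route; NO CLAIM BEYOND
STATED CLASSES; the classes served (O10-PS = X12 ∩ CM-inert ∩ Kodaira `I₀*`; O5a / O7-ss ∩ `e = 2`)
stay CONSTRUCTION-SHAPED and OPEN; nothing here changes a label or a mark; census / instrument output
is EVIDENCE, never a Literature fact. THEOREMS ONLY (0 definitions, 0 named facts minted, 0 `sorry`):
every conclusion is CONDITIONAL on its displayed hypotheses; the typed `@[conjecture]` items appear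
ONLY as hypotheses / inside the conclusion's own hypothesis and are NOT claimed.

## What (x1b GEN 45)

`Additive/QuadraticBranchSignedMainConjecture.lean` §3 types OUR CONJECTURE (C2_η)
`QuadraticBranchRankOneLinkAt W p`: for every globally minimal model `V` of the `p*`-twist of `W`
(`C • W^{(p*)} = V`) with good reduction at the odd prime `p` and `a_p(V) = 0`, and `r_an(W) = 1`,
**(C1_η) `QuadraticBranchPlusMainConjectureAt V p` ⟹ `PPart W p`** — the shape of
Burungale–Kobayashi–Ota App. A Cor. A.5 transposed to the additive twist (Perrin-Riou's argument on the
branch; NO SOURCE proves it; Tian, Proc. ICM 2022, p. 1993 — substitute source (Tian) — attributes the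
CM case `e = 2` to J. Pan's 2017 thesis). The cell's ledgers list it as OPEN beside the two REFINED
inputs (C2_η-GZ) = C-cc-1 `QuadraticBranchPAdicGrossZagierValuationAt W p` (the pre-registered
valuation law for the leading coefficient of Kobayashi's `L_p⁻(V, η, X)`; EVIDENCE item) and (C3_η)
(exact control; DISCHARGED modulo readings by x1b GEN 44's file 123). x1b GEN 44's file 124
(`LevelBridge.pPart_of_plusMC_of_pAdicGrossZagierValuation_of_readings`) proves
`PPart W p ∧ MissingPPartAt W p` from (C1_η) ∧ (C2_η-GZ) at explicit PAIR DATA (newform `f`, period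
ratio `ϖ`, a branch function `L`, a generator `P` of `W(ℚ)/tors` of exact level `n` in `W(ℚ_p)`,
`W(ℚ_p)[p] = 0`), given the named facts `hmod` (entire `L`), `hGZ` (Gross–Zagier I.(7.3)), `hGZK`
(Gross–Zagier–Kolyvagin), `hPT` (finite-level Poitou–Tate for Selmer structures), the cell-typed
reading (R2) `OddBranchStrictMinusNoFiniteSubmoduleAt W p` (Kitajima–Otsuki 2018 Main Thm. 1.3, sign
`−`, `η`-part) and the hypothesis TEXT `h74x` (EXACT reading of Kobayashi 2003 Thm. 7.4 at `η`: under
(C1_η) at the twin, `char_Λ X^{−,str}(W/ℚ_∞) = (L')` for `L_p⁻(V, η, X) = X·L'`). Here the pair data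
are PRODUCED (modularity `hnf`: the newform; GZK + Mordell–Weil: a generator,
`exists_generator_of_mordellWeilRank_eq_one`; its `p`-divisibility level:
`StrictSha.exists_level_of_not_isOfFinAddOrder`; `W(ℚ_p)[p] = 0` for the `p*`-twist of a good
`a_p = 0` curve: `eq_zero_of_prime_smul_eq_zero_padic_of_quadraticTwist_goodSupersingular`; the
displayed analytic existence binder `hdata` = period ratio `ϖ` + a branch function, the latter
dischargeable by `exists_isQuadraticBranchMinusLFunction_of_isNewformOf`), so that:
* `quadraticBranchRankOneLinkAt_of_pAdicGrossZagierValuation_of_readings` — **(C2_η)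
  `QuadraticBranchRankOneLinkAt W p` for `p ≥ 5` ⟸ C-cc-1 at `(W, p)` + `hmod hGZ hGZK hPT hnf` +
  `hdata` + (R2) + `h74x`**;
* `quadraticBranchRankOneLinkAt_of_pAdicGrossZagierValuation_of_kitajimaOtsuki` — the same with the
  Kitajima–Otsuki input in its VERBATIM SHAPE `hKO` (cc-typer-6's text `HKO p`, dictionary theorem
  P5-5b `SignedTwist.oddBranchStrictMinusNoFiniteSubmoduleAt_of_kitajimaOtsuki13MinusEta`);
* `quadraticBranchRankOneLinkAt_of_pAdicGrossZagierValuation_of_readings_of_periodRatio` — `hdata`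
  REDUCED to a `p`-integral period ratio (`quadraticBranch_hdata_of_periodRatio`).
NET for the ledgers (nothing booked; no mark / label / tier / count moves): in the kernel, at `p ≥ 5`
the typed item (C2_η) is no longer an independent input — it FOLLOWS from C-cc-1 given
`hmod/hGZ/hGZK/hPT/hnf`, the period-ratio datum and the readings (R2) + `h74x`; so on O10-PS and on
O5a / O7-ss ∩ `e = 2` the residue of record reads (C1_η) + C-cc-1 (+ readings). (C1_η) is a
CONJECTURE IN PRINT; C-cc-1 is an EVIDENCE item; (R2) is a typed READING of a printed theorem; `h74x` a
hypothesis text; NOTHING is claimed about any curve.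

References (locators only): [Kobayashi2003] Thm. 3.2 (p. 7), §4 (p. 8), Thm. 7.4 (p. 13), Thm. 9.3
(p. 26); [KitajimaOtsuki2018] Main Thm. 1.3, Def. 2.1; [BurungaleKobayashiOta2023] App. A Cor. A.5
(shape only); [Miller2011LMS] §1, Def. 1.1; [GrossZagier1986] Thm. I.(7.3); [SilvermanAEC2009]
VII.6.3, VIII.6.7; [Tian2023CongruentICM] p. 1993; [SerreInventiones1972] §1.11 Prop. 12.
-/

noncomputable section

open scoped Classical MatrixGroups ModularForm NumberField

open CongruenceSubgroup WeierstrassCurve Literature.NumberTheory.EllipticCurves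
  Literature.NumberTheory.EllipticCurves.ModularForms
  Literature.NumberTheory.EllipticCurves.Kobayashi2003
  Literature.NumberTheory.EllipticCurves.Rank1Residual
  Literature.NumberTheory.EllipticCurves.Rank1Residual.Typed
  Literature.NumberTheory.GaloisRepresentations
  Literature.NumberTheory.GaloisCohomology
  Literature.NumberTheory.EllipticCurves.IwasawaAlgebra

namespace Summit.BirchSwinnertonDyer.Rank1Residual.Additive.LevelBridge

variable (W : WeierstrassCurve ℚ) [W.IsElliptic] [W.IsGloballyMinimal] (p : ℕ) [hp : Fact p.Prime]

/-! ## §1 The pair data of file 124, PRODUCED for a rank-one `p*`-twist of a good `a_p = 0` curve -/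

omit [W.IsGloballyMinimal] in
/-- **The pair data of file 124 exist**: for `W` of analytic rank one and a globally minimal model `V`
of its `p*`-twist (`C • W^{(p*)} = V`) with good reduction at `p ≥ 5` and `a_p(V) = 0`, given GZK
(`rank W(ℚ) = 1`), modularity `hnf` and the displayed analytic existence binder `hdata`: a newform `f`
of `V`, a period ratio `ϖ` with a branch function `L` (`IsQuadraticBranchMinusLFunction f p ϖ L`),
`W(ℚ_p)[p] = 0`, and a generator `P` of `W(ℚ)` modulo torsion of exact `p`-divisibility level `n` in
`W(ℚ_p)` (Mordell–Weil; the finite-index open subgroup `λ = 0` of `W(ℚ_p)`, AEC VII.6.3). Bookkeeping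
over tree theorems; CONDITIONAL on the displayed hypotheses; nothing booked.
[cite: SilvermanAEC2009, Prop. VII.6.3 and Thm. VIII.6.7] [cite: SerreInventiones1972, §1.11 Prop. 12]
[cite: Kobayashi2003, Thm. 3.2 (p. 7)] -/
theorem exists_pairData_of_quadraticTwist_goodSupersingular
    (hGZK : rank_eq_analyticRank_of_analyticRank_le_one) (hnf : exists_isNewformOf)
    (hdata : ∀ (V : WeierstrassCurve ℚ) [V.IsElliptic] [V.IsGloballyMinimal]
      {N : ℕ} [NeZero N] (f : CuspForm (Gamma0 N) 2), IsNewformOf V f →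
      V.HasGoodReductionAtPrime p → V.frobeniusTrace p = 0 →
      ∃ ϖ : ℚ, (if Even (p / 2) then (ϖ : ℝ) * V.realPeriodRat = plusPeriod f
          else (ϖ : ℝ) * V.imaginaryPeriodRat = minusPeriod f) ∧
        ∃ L : IwasawaAlgebra p, IsQuadraticBranchMinusLFunction f p ϖ L)
    {V : WeierstrassCurve ℚ} [V.IsElliptic] [V.IsGloballyMinimal] {C : VariableChange ℚ}
    (hp5 : 5 ≤ p) (hC : C • W.quadraticTwist ((-1) ^ (p / 2) * p) = V)
    (hgood : V.HasGoodReductionAtPrime p) (hap : V.frobeniusTrace p = 0) (hr : W.analyticRank = 1) :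
    ∃ (N : ℕ) (_ : NeZero N) (f : CuspForm (Gamma0 N) 2) (ϖ : ℚ) (L : IwasawaAlgebra p)
      (P : W.toAffine.Point) (n : ℕ),
      IsNewformOf V f ∧
      (if Even (p / 2) then (ϖ : ℝ) * V.realPeriodRat = plusPeriod f
        else (ϖ : ℝ) * V.imaginaryPeriodRat = minusPeriod f) ∧
      IsQuadraticBranchMinusLFunction f p ϖ L ∧
      (∀ Q : (W.baseChange ℚ_[p]).toAffine.Point, p • Q = 0 → Q = 0) ∧
      ¬ IsOfFinAddOrder P ∧
      (∀ R : W.toAffine.Point, ∃ (k : ℤ) (T : W.toAffine.Point), IsOfFinAddOrder T ∧ R = k • P + T) ∧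
      (∃ Q : (W.baseChange ℚ_[p]).toAffine.Point, p ^ n • Q = W.toPadicPoint p P) ∧
      (∀ Q : (W.baseChange ℚ_[p]).toAffine.Point, p ^ (n + 1) • Q ≠ W.toPadicPoint p P) := by
  -- the newform of the twin (modularity) and the displayed analytic data
  haveI : NeZero (V.conductorNorm ℤ) := ⟨(V.conductorNorm_pos_holds).ne'⟩
  obtain ⟨f, hf⟩ := hnf V
  obtain ⟨ϖ, hϖ, L, hL⟩ := hdata V f hf hgood hap
  -- Mordell–Weil: rank one (GZK), a generator modulo torsion, and its `p`-divisibility level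
  obtain ⟨hrank, -⟩ := hGZK W hr.le
  have hrank1 : W.mordellWeilRank = 1 := by rw [hrank, hr]
  obtain ⟨P, hP, hgen⟩ := exists_generator_of_mordellWeilRank_eq_one W hrank1
  obtain ⟨lam, hlam⟩ := exists_addMonoidHom_padicInt_apply_eq_zero_iff p (W.baseChange ℚ_[p])
  have hinj : Function.Injective (W.toPadicPoint p) :=
    Affine.Point.map_injective (W' := W) (Algebra.ofId ℚ ℚ_[p])
  have hP' : ¬ IsOfFinAddOrder P := by convert hP
  have hPp : ¬ IsOfFinAddOrder (W.toPadicPoint p P) := by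
    intro h
    apply hP'
    obtain ⟨m, hm, hmP⟩ := isOfFinAddOrder_iff_nsmul_eq_zero.mp h
    refine isOfFinAddOrder_iff_nsmul_eq_zero.mpr ⟨m, hm, hinj ?_⟩
    rw [map_nsmul, map_zero]
    exact hmP
  obtain ⟨n, hdiv, hndiv⟩ := StrictSha.exists_level_of_not_isOfFinAddOrder p lam hlam hPp
  have hgen' : ∀ R : W.toAffine.Point, ∃ (k : ℤ) (T : W.toAffine.Point),
      IsOfFinAddOrder T ∧ R = k • P + T := fun R ↦ by
    obtain ⟨a, t, ht, hR⟩ := hgen R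
    exact ⟨a, t, by convert ht, by convert hR⟩
  -- `W(ℚ_p)[p] = 0` for the `p*`-twist of a good `a_p = 0` curve, `p` odd
  have htors : ∀ Q : (W.baseChange ℚ_[p]).toAffine.Point, p • Q = 0 → Q = 0 :=
    eq_zero_of_prime_smul_eq_zero_padic_of_quadraticTwist_goodSupersingular (by omega) W C V hC
      hgood hap
  exact ⟨V.conductorNorm ℤ, inferInstance, f, ϖ, L, P, n, hf, hϖ, hL, htors, hP', hgen', hdiv, hndiv⟩

/-! ## §2 (C2_η) from C-cc-1, the named facts and the readings of file 124 -/

/-- **(C2_η) `QuadraticBranchRankOneLinkAt W p` for `p ≥ 5`** ⟸ C-cc-1 = (C2_η-GZ) at `(W, p)` (`h2`),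
the named facts `hmod`, `hGZ`, `hGZK`, `hPT`, modularity `hnf`, the displayed analytic existence
binder `hdata`, the cell-typed reading (R2) `OddBranchStrictMinusNoFiniteSubmoduleAt W p`
(Kitajima–Otsuki 2018 Main Thm. 1.3 sign `−` on the `η`-part; `@[conjecture]`-typed READING, not
claimed) and the EXACT odd-`η` reading `h74x` for `W` (hypothesis TEXT; Kobayashi Thm. 7.4 at `η`).
Proof: unfold the link; for the given twin `V`, change of variables `C` and (C1_η) at `V`, produce
the pair data (§1) and apply file 124's `pPart_of_plusMC_of_pAdicGrossZagierValuation_of_readings`.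
CONDITIONAL on every displayed hypothesis; C-cc-1 NOT claimed; (C1_η) appears only inside the
conclusion's own hypothesis; nothing booked; O10 / O7-ss stay OPEN.
[cite: BurungaleKobayashiOta2023, App. A Cor. A.5 (shape only; nothing asserted)]
[cite: KitajimaOtsuki2018, Main Thm. 1.3 (= Thm. 4.8) with Def. 2.1 (arXiv:1607.03612 pp. 3, 6)]
[cite: Kobayashi2003, §4 (p. 8), Thm. 7.4 (p. 13), Thm. 9.3 (p. 26)] [cite: Miller2011LMS, §1 and Def. 1.1] -/
theorem quadraticBranchRankOneLinkAt_of_pAdicGrossZagierValuation_of_readings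
    (hmod : hasEntireLFunction_rat) (hGZ : GrossZagier1986_thm_I_7_3)
    (hGZK : rank_eq_analyticRank_of_analyticRank_le_one)
    (hPT : poitouTate_selmerStructure_duality_real ℚ) (hnf : exists_isNewformOf)
    (hdata : ∀ (V : WeierstrassCurve ℚ) [V.IsElliptic] [V.IsGloballyMinimal]
      {N : ℕ} [NeZero N] (f : CuspForm (Gamma0 N) 2), IsNewformOf V f →
      V.HasGoodReductionAtPrime p → V.frobeniusTrace p = 0 →
      ∃ ϖ : ℚ, (if Even (p / 2) then (ϖ : ℝ) * V.realPeriodRat = plusPeriod f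
          else (ϖ : ℝ) * V.imaginaryPeriodRat = minusPeriod f) ∧
        ∃ L : IwasawaAlgebra p, IsQuadraticBranchMinusLFunction f p ϖ L)
    (hR2 : OddBranchStrictMinusNoFiniteSubmoduleAt W p)
    (h74x : ∀ (V : WeierstrassCurve ℚ) [V.IsElliptic] [V.IsGloballyMinimal] (C : VariableChange ℚ)
        {N : ℕ} [NeZero N] {f : CuspForm (Gamma0 N) 2},
        p ≠ 2 → C • W.quadraticTwist ((-1) ^ (p / 2) * p) = V →
        V.HasGoodReductionAtPrime p → V.frobeniusTrace p = 0 →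
        QuadraticBranchPlusMainConjectureAt V p → IsNewformOf V f →
        ∀ (ϖ : ℚ), (if Even (p / 2) then (ϖ : ℝ) * V.realPeriodRat = plusPeriod f
            else (ϖ : ℝ) * V.imaginaryPeriodRat = minusPeriod f) →
        ∀ (Lη : IwasawaAlgebra p), IsQuadraticBranchMinusLFunction f p ϖ Lη →
        ∀ (κ : ZpExtension ℚ p) (γ : Field.absoluteGaloisGroup ℚ),
          κ.IsCyclotomic → κ.IsTopGenerator γ → IsCyclotomicVariable p γ →
        ∀ (D : StrictSignedSelmerDualData W κ ℚ_[p] γ (-1)) (L' : IwasawaAlgebra p),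
          Lη = PowerSeries.X * L' → D.charIdeal = Ideal.span {L'})
    (h2 : QuadraticBranchPAdicGrossZagierValuationAt W p) (hp5 : 5 ≤ p) :
    QuadraticBranchRankOneLinkAt W p := by
  intro V _ _ C _ hC hgood hap hr h1
  obtain ⟨N, _, f, ϖ, L, P, n, hf, hϖ, hL, htors, hP, hgen, hdiv, hndiv⟩ :=
    exists_pairData_of_quadraticTwist_goodSupersingular W p hGZK hnf hdata hp5 hC hgood hap hr
  exact (pPart_of_plusMC_of_pAdicGrossZagierValuation_of_readings W p hmod hGZ hGZK hPT hR2 h74x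
    ((quadraticBranchPAdicGrossZagierValuationAt_iff W p).mp h2) hp5 hC hgood hap h1 hf hϖ hL htors hP
    hgen hdiv hndiv hr).1

/-- **The same with the Kitajima–Otsuki input in its VERBATIM SHAPE `hKO`** (cc-typer-6's text `HKO p`
on the tree's `η`-part object; dictionary theorem P5-5b
`SignedTwist.oddBranchStrictMinusNoFiniteSubmoduleAt_of_kitajimaOtsuki13MinusEta`). CONDITIONAL on
every displayed hypothesis; nothing booked.
[cite: KitajimaOtsuki2018, Main Thm. 1.3 (= Thm. 4.8) with Def. 2.1 (arXiv:1607.03612 pp. 3, 6)]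
[cite: Kobayashi2003, §4 (p. 8), Thm. 7.4 (p. 13)] [cite: Miller2011LMS, §1 and Def. 1.1] -/
theorem quadraticBranchRankOneLinkAt_of_pAdicGrossZagierValuation_of_kitajimaOtsuki
    (hmod : hasEntireLFunction_rat) (hGZ : GrossZagier1986_thm_I_7_3)
    (hGZK : rank_eq_analyticRank_of_analyticRank_le_one)
    (hPT : poitouTate_selmerStructure_duality_real ℚ) (hnf : exists_isNewformOf)
    (hdata : ∀ (V : WeierstrassCurve ℚ) [V.IsElliptic] [V.IsGloballyMinimal]
      {N : ℕ} [NeZero N] (f : CuspForm (Gamma0 N) 2), IsNewformOf V f →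
      V.HasGoodReductionAtPrime p → V.frobeniusTrace p = 0 →
      ∃ ϖ : ℚ, (if Even (p / 2) then (ϖ : ℝ) * V.realPeriodRat = plusPeriod f
          else (ϖ : ℝ) * V.imaginaryPeriodRat = minusPeriod f) ∧
        ∃ L : IwasawaAlgebra p, IsQuadraticBranchMinusLFunction f p ϖ L)
    (hKO : ∀ (K₀ : Type) [Field K₀] [NumberField K₀] [IsCyclotomicExtension {p} ℚ K₀]
        [(galRange (K := ℚ) K₀).Normal] (ηq : Field.absoluteGaloisGroup ℚ →* ℤˣ),
        (∀ σ ∈ galRange (K := ℚ) K₀, ηq σ = 1) →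
      ∀ (V : WeierstrassCurve ℚ) [V.IsElliptic] [V.IsGloballyMinimal],
        p ≠ 2 → V.HasGoodReductionAtPrime p → V.frobeniusTrace p = 0 →
      ∀ (κ : ZpExtension ℚ p) (γ : Field.absoluteGaloisGroup ℚ),
        κ.IsCyclotomic → κ.IsTopGenerator γ → γ ∈ galRange (K := ℚ) K₀ →
      ∀ (D : EtaSignedSelmerDualData V κ K₀ ℚ_[p] ηq γ (-1)),
        Module.Finite (IwasawaAlgebra p) D.X → Module.IsTorsion (IwasawaAlgebra p) D.X →
        ∀ M : Submodule (IwasawaAlgebra p) D.X, Finite M → M = ⊥)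
    (h74x : ∀ (V : WeierstrassCurve ℚ) [V.IsElliptic] [V.IsGloballyMinimal] (C : VariableChange ℚ)
        {N : ℕ} [NeZero N] {f : CuspForm (Gamma0 N) 2},
        p ≠ 2 → C • W.quadraticTwist ((-1) ^ (p / 2) * p) = V →
        V.HasGoodReductionAtPrime p → V.frobeniusTrace p = 0 →
        QuadraticBranchPlusMainConjectureAt V p → IsNewformOf V f →
        ∀ (ϖ : ℚ), (if Even (p / 2) then (ϖ : ℝ) * V.realPeriodRat = plusPeriod f
            else (ϖ : ℝ) * V.imaginaryPeriodRat = minusPeriod f) →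
        ∀ (Lη : IwasawaAlgebra p), IsQuadraticBranchMinusLFunction f p ϖ Lη →
        ∀ (κ : ZpExtension ℚ p) (γ : Field.absoluteGaloisGroup ℚ),
          κ.IsCyclotomic → κ.IsTopGenerator γ → IsCyclotomicVariable p γ →
        ∀ (D : StrictSignedSelmerDualData W κ ℚ_[p] γ (-1)) (L' : IwasawaAlgebra p),
          Lη = PowerSeries.X * L' → D.charIdeal = Ideal.span {L'})
    (h2 : QuadraticBranchPAdicGrossZagierValuationAt W p) (hp5 : 5 ≤ p) :
    QuadraticBranchRankOneLinkAt W p :=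
  quadraticBranchRankOneLinkAt_of_pAdicGrossZagierValuation_of_readings W p hmod hGZ hGZK hPT hnf hdata
    (SignedTwist.oddBranchStrictMinusNoFiniteSubmoduleAt_of_kitajimaOtsuki13MinusEta W p hKO) h74x h2 hp5

/-- **The same with the analytic binder REDUCED to the period ratio**: `hdata` is supplied from a
`p`-INTEGRAL rational period ratio `ϖ` of the parity of `η` for every good `a_p = 0` curve (`hper`),
the existence of Kobayashi's `L_p⁻(V, η, X)` being the tree theorem
`exists_isQuadraticBranchMinusLFunction_of_isNewformOf` (Kobayashi Thm. 3.2 = Pollack;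
`quadraticBranch_hdata_of_periodRatio`). CONDITIONAL on every displayed hypothesis; nothing booked.
[cite: Kobayashi2003, Thm. 3.2, (3.5) and (3.7) (p. 7)] [cite: Pollack2003, Thm. 5.6 and Prop. 6.18]
[cite: Miller2011LMS, §1 and Def. 1.1] -/
theorem quadraticBranchRankOneLinkAt_of_pAdicGrossZagierValuation_of_readings_of_periodRatio
    (hmod : hasEntireLFunction_rat) (hGZ : GrossZagier1986_thm_I_7_3)
    (hGZK : rank_eq_analyticRank_of_analyticRank_le_one)
    (hPT : poitouTate_selmerStructure_duality_real ℚ) (hnf : exists_isNewformOf)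
    (hper : ∀ (V : WeierstrassCurve ℚ) [V.IsElliptic] [V.IsGloballyMinimal]
      {N : ℕ} [NeZero N] (f : CuspForm (Gamma0 N) 2), IsNewformOf V f →
      V.HasGoodReductionAtPrime p → V.frobeniusTrace p = 0 →
      ∃ ϖ : ℚ, ‖(ϖ : ℚ_[p])‖ ≤ 1 ∧
        (if Even (p / 2) then (ϖ : ℝ) * V.realPeriodRat = plusPeriod f
          else (ϖ : ℝ) * V.imaginaryPeriodRat = minusPeriod f))
    (hR2 : OddBranchStrictMinusNoFiniteSubmoduleAt W p)
    (h74x : ∀ (V : WeierstrassCurve ℚ) [V.IsElliptic] [V.IsGloballyMinimal] (C : VariableChange ℚ)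
        {N : ℕ} [NeZero N] {f : CuspForm (Gamma0 N) 2},
        p ≠ 2 → C • W.quadraticTwist ((-1) ^ (p / 2) * p) = V →
        V.HasGoodReductionAtPrime p → V.frobeniusTrace p = 0 →
        QuadraticBranchPlusMainConjectureAt V p → IsNewformOf V f →
        ∀ (ϖ : ℚ), (if Even (p / 2) then (ϖ : ℝ) * V.realPeriodRat = plusPeriod f
            else (ϖ : ℝ) * V.imaginaryPeriodRat = minusPeriod f) →
        ∀ (Lη : IwasawaAlgebra p), IsQuadraticBranchMinusLFunction f p ϖ Lη →
        ∀ (κ : ZpExtension ℚ p) (γ : Field.absoluteGaloisGroup ℚ),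
          κ.IsCyclotomic → κ.IsTopGenerator γ → IsCyclotomicVariable p γ →
        ∀ (D : StrictSignedSelmerDualData W κ ℚ_[p] γ (-1)) (L' : IwasawaAlgebra p),
          Lη = PowerSeries.X * L' → D.charIdeal = Ideal.span {L'})
    (h2 : QuadraticBranchPAdicGrossZagierValuationAt W p) (hp5 : 5 ≤ p) :
    QuadraticBranchRankOneLinkAt W p :=
  quadraticBranchRankOneLinkAt_of_pAdicGrossZagierValuation_of_readings W p hmod hGZ hGZK hPT hnf
    (fun V _ _ _ _ f hf hgood hap ↦ quadraticBranch_hdata_of_periodRatio (by omega) hper V f hf hgood hap)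
    hR2 h74x h2 hp5

end Summit.BirchSwinnertonDyer.Rank1Residual.Additive.LevelBridge

end
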